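import Summits.ABC.ABC.Theorems.PrimePowerRadical.Negative.NonWieferich

/-!
# `PrimePowerRadical` (stmt-ABC-1648): De Leon's lemma and the Mersenne identity

Negative-side analysis (cdisprove seat, cycle 2), elementary consequences of the exact valuations
`padicValNat_family` (`Negative/WieferichValuations.lean`):
* `sq_dvd_of_two_le_wieferichLevel` — De Leon's lemma (1978; Ribenboim 1989, Ch. 5 §III, PDF p. 201): a
  Wieferich prime to base `q` divides every `q^k − 1` it divides to at least the second power; and the converse
  bookkeeping `padicValNat_family_eq_one`;
* `sq_dvd_mersenne_iff_isWieferich` — Rotkiewicz 1965 / Warren–Bray 1967 (ibid. PDF p. 203): a prime factor of a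
  Mersenne number `2^ℓ − 1` (`ℓ` prime) is repeated iff it is a Wieferich prime;
* `oddWieferichExcess_mul_radical_mersenne` — for a prime `ℓ`, `E_W(2,ℓ) · rad(2^ℓ − 1) = 2^ℓ − 1` EXACTLY: at
  `(q,k) = (2, ℓ)` the crux is "the repeated part of `M_ℓ` is `2^{o(ℓ)}`", a quantitative shadow of
  "is `2^p − 1` always squarefree? … unanswerable" (Guy, UPINT 1994, A3, PDF p. 21).
-/

noncomputable section

namespace Summit.ABC.ABC.Theorems.PrimePowerRadical.Negative

open Literature.NumberTheory.DiophantineGeometry UniqueFactorizationMonoid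
open Summit.ABC.ABC.Theses.IneffectiveSubspace

/-- **De Leon's lemma (1978)** in level form: an odd prime of Wieferich level `≥ 2` to base `q` divides
every member `q^k − 1` of the family that it divides at all to at least the second power. [folklore] -/
theorem sq_dvd_of_two_le_wieferichLevel {q p k : ℕ} (hq : 2 ≤ q) (hp : p.Prime) (hp2 : p ≠ 2)
    (hk : 1 ≤ k) (hpk : p ∣ q ^ k - 1) (hW : 2 ≤ wieferichLevel q p) : p ^ 2 ∣ q ^ k - 1 := by
  haveI := Fact.mk hp
  have hn : q ^ k - 1 ≠ 0 := by have := two_le_pow hq hk; omega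
  refine (padicValNat_dvd_iff_le hn).mpr ?_
  rw [padicValNat_family hq hp hp2 hk hpk]
  omega

/-- Conversely a non-Wieferich odd prime `p ∤ k` divides `q^k − 1` at most simply. [folklore] -/
theorem padicValNat_family_eq_one {q p k : ℕ} (hq : 2 ≤ q) (hp : p.Prime) (hp2 : p ≠ 2)
    (hk : 1 ≤ k) (hpk : p ∣ q ^ k - 1) (hpk' : ¬ p ∣ k) (hW : wieferichLevel q p ≤ 1) :
    padicValNat p (q ^ k - 1) = 1 := by
  haveI := Fact.mk hp
  have hpq : ¬ p ∣ q := not_dvd_base_of_dvd hp hk (by omega) hpk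
  have h1 := one_le_wieferichLevel hp hq hpq
  rw [padicValNat_family hq hp hp2 hk hpk, padicValNat.eq_zero_of_not_dvd hpk']
  omega

/-- A prime `ℓ` never divides `2^ℓ − 1`. [folklore] -/
theorem not_self_dvd_mersenne {ℓ : ℕ} (hℓ : ℓ.Prime) : ¬ ℓ ∣ 2 ^ ℓ - 1 := by
  intro h
  rcases eq_or_ne ℓ 2 with rfl | hℓ2
  · norm_num at h
  -- Fermat: ℓ ∣ 2^(ℓ-1) - 1, hence ℓ ∣ 2^ℓ - 2; together with ℓ ∣ 2^ℓ - 1 this gives ℓ ∣ 1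
  have hcop : Nat.Coprime 2 ℓ := (Nat.coprime_primes Nat.prime_two hℓ).mpr (Ne.symm hℓ2)
  have hF : 2 ^ (ℓ - 1) ≡ 1 [MOD ℓ] := by
    have := Nat.ModEq.pow_totient hcop
    rwa [Nat.totient_prime hℓ] at this
  have hF' : ℓ ∣ 2 ^ (ℓ - 1) - 1 := (Nat.modEq_iff_dvd' (Nat.one_le_two_pow)).mp hF.symm
  have h2 : ℓ ∣ 2 * (2 ^ (ℓ - 1) - 1) := dvd_mul_of_dvd_right hF' 2
  have e : 2 * (2 ^ (ℓ - 1) - 1) = 2 ^ ℓ - 1 - 1 := by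
    have : 2 ^ ℓ = 2 * 2 ^ (ℓ - 1) := by
      rw [← pow_succ']; congr 1; have := hℓ.two_le; omega
    omega
  rw [e] at h2
  have h1 : 1 ≤ 2 ^ ℓ - 1 := by
    have : 2 ≤ 2 ^ ℓ := two_le_pow le_rfl (by have := hℓ.two_le; omega)
    omega
  have h3 : ℓ ∣ 2 ^ ℓ - 1 - (2 ^ ℓ - 1 - 1) := Nat.dvd_sub h h2
  rw [Nat.sub_sub_self h1] at h3
  exact hℓ.one_lt.ne' (Nat.dvd_one.mp h3)

/-- **Rotkiewicz 1965 / Warren–Bray 1967**: a prime factor `p` of a Mersenne number `2^ℓ − 1` (`ℓ` prime)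
divides it to the second power iff `p` is a Wieferich prime (base 2). [folklore] -/
theorem sq_dvd_mersenne_iff_isWieferich {ℓ p : ℕ} (hℓ : ℓ.Prime) (hp : p.Prime)
    (hpm : p ∣ 2 ^ ℓ - 1) : p ^ 2 ∣ 2 ^ ℓ - 1 ↔ IsWieferich 2 p := by
  haveI := Fact.mk hp
  have hℓ1 : 1 ≤ ℓ := hℓ.one_lt.le
  have hp2 : p ≠ 2 := by
    rintro rfl
    exact (not_dvd_base_of_dvd Nat.prime_two hℓ1 (by norm_num) hpm) (dvd_refl 2)
  have hpq : ¬ p ∣ 2 := not_dvd_base_of_dvd hp hℓ1 (by norm_num) hpm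
  have hpl : ¬ p ∣ ℓ := by
    intro h
    have := (Nat.prime_dvd_prime_iff_eq hp hℓ).mp h
    subst this
    exact not_self_dvd_mersenne hp hpm
  have hn : 2 ^ ℓ - 1 ≠ 0 := by have := two_le_pow (le_refl 2) hℓ1; omega
  rw [isWieferich_iff_two_le_wieferichLevel (le_refl 2) hp hp2 hpq, padicValNat_dvd_iff_le hn,
    padicValNat_family (le_refl 2) hp hp2 hℓ1 hpm, padicValNat.eq_zero_of_not_dvd hpl, add_zero]

/-- **For Mersenne numbers the powerful excess IS the Wieferich excess, exactly**: for a prime `ℓ`,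
`E_W(2,ℓ) · rad(2^ℓ − 1) = 2^ℓ − 1` (no `ℓ`-part, no `2`-part). So the crux at `(q,k) = (2, ℓ prime)`
reads: the Wieferich-square part of `2^ℓ − 1` is `2^{o(ℓ)}` — a quantitative shadow of "are Mersenne
numbers squarefree?" (Guy, UPINT A3). [folklore] -/
theorem oddWieferichExcess_mul_radical_mersenne {ℓ : ℕ} (hℓ : ℓ.Prime) :
    oddWieferichExcess 2 ℓ * radical (2 ^ ℓ - 1) = 2 ^ ℓ - 1 := by
  have hℓ1 : 1 ≤ ℓ := hℓ.one_lt.le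
  have hn : 2 ^ ℓ - 1 ≠ 0 := by have := two_le_pow (le_refl 2) hℓ1; omega
  have hE := (oddWieferichExcess_pos 2 ℓ).ne'
  have hR : radical (2 ^ ℓ - 1) ≠ 0 := radical_ne_zero
  apply Nat.eq_of_factorization_eq (mul_ne_zero hE hR) hn
  intro p
  rw [Nat.factorization_mul hE hR, Finsupp.add_apply, factorization_oddWieferichExcess,
    factorization_radical]
  by_cases hpP : p ∈ (2 ^ ℓ - 1).primeFactors
  · have hp : p.Prime := Nat.prime_of_mem_primeFactors hpP
    have hpk : p ∣ 2 ^ ℓ - 1 := Nat.dvd_of_mem_primeFactors hpP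
    haveI := Fact.mk hp
    have hp2 : p ≠ 2 := by
      rintro rfl
      exact (not_dvd_base_of_dvd Nat.prime_two hℓ1 (by norm_num) hpk) (dvd_refl 2)
    have hpl : ¬ p ∣ ℓ := by
      intro h
      have := (Nat.prime_dvd_prime_iff_eq hp hℓ).mp h
      subst this
      exact not_self_dvd_mersenne hp hpk
    rw [if_pos (Finset.mem_erase.mpr ⟨hp2, hpP⟩), if_pos hpP, Nat.factorization_def _ hp,
      padicValNat_family (le_refl 2) hp hp2 hℓ1 hpk, padicValNat.eq_zero_of_not_dvd hpl]
    have := one_le_wieferichLevel hp (le_refl 2) (not_dvd_base_of_dvd hp hℓ1 (by norm_num) hpk)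
    omega
  · have h1 : p ∉ (2 ^ ℓ - 1).primeFactors.erase 2 := fun h => hpP (Finset.mem_of_mem_erase h)
    rw [if_neg h1, if_neg hpP]
    by_cases hp : p.Prime
    · rw [Nat.factorization_def _ hp,
        padicValNat.eq_zero_of_not_dvd fun h => hpP (Nat.mem_primeFactors.mpr ⟨hp, h, hn⟩)]
    · simp [Nat.factorization_eq_zero_of_not_prime _ hp]

end Summit.ABC.ABC.Theorems.PrimePowerRadical.Negative

end
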